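import Summits.RiemannHypothesis.RiemannHypothesis.Theorems.WeilFormatCTailEvenJJ
import Summits.RiemannHypothesis.RiemannHypothesis.Theorems.WeilFormatCTailJJMatrixAlgebra
import HarnessLib

/-!
# Format C, L-C3b (even sector): the joint (`TJ`) tail majorant — matrix form

Route context: Fourier–Galerkin / Schur-complement certificates of Weil positivity on a window ("format C";
cell memo `run/shared/lean/pub/rh-explicit/rh-explicit-weil-10/FORMATC-DESIGN.md` §9.9.7; supporting
stmt-RiemannHypothesis-0098; seat rh-explicit-weil-10).  `WeilFormatC.even_tailJJ_majorant` rewritten as `xᵀU₂x` for the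
explicit entrywise matrix `U₂` — literally the `hU2e` premise of the generic door
`WeilFormatC.weilPositivityOn_of_formatC_kernels` (a rung certificate reads
`weilPositivityOn_of_formatC_kernels ha hBe hBBe we h0e hd0e hwe U2e (fun d hd N x ↦ even_tailJJ_majorant_matrix ha hB hBB hB₃ J d hd₀ hd hθ s₁ sm sp hs₁ hsm hsp N x) hSe …`).
Entry layout (for weil-2's transcription `U2EvenJJ`): `(1+θ)/d₀ · [(1 + c/π)·(eight joint zeta blocks, A rows scaled
by 1/4) + (c/π + c̄₂/π²)·(two A-family zeta blocks) + π⁻²·(pair Gershgorin) + (2π)⁻¹·(single Gershgorin A×A)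
+ π⁻¹·(single Gershgorin A×B, both diagonals)] + δ_{ii'}·(1+θ⁻¹)(B/d₀)ρ_i²/((4J+1)(B₃−1)^{4J+1})`.

* `even_tailJJ_majorant_matrix`.

Standard axioms; no definitions; no RH claim.
-/

set_option autoImplicit false
-- `Summit.RiemannHypothesis.RiemannHypothesis.…` is the layout-mandated namespace (summit = problem name).
set_option linter.dupNamespace false

noncomputable section

open Complex Finset Matrix
open scoped Real BigOperators ArithmeticFunction.vonMangoldt

namespace Summit.RiemannHypothesis.RiemannHypothesis.Theorems.WeilFormatC

open Literature.NumberTheory.LFunctions Literature.NumberTheory.LFunctions.Yoshida1992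
open Literature.Analysis.SpecialFunctions

variable {a : ℝ}

/-! ## The matrix form -/

section Tail

/-- **Even tail majorant at order `J`, joint `A/B` form — matrix form** (`hU2e` of
`weilPositivityOn_of_formatC_kernels`). -/
theorem even_tailJJ_majorant_matrix (ha : 0 < a) {B B₃ : ℕ} (hB : 1 ≤ B) (hBB : 2 * B ≤ B₃) (hB₃ : 2 ≤ B₃) (J : ℕ)
    (d : ℕ → ℝ) {d₀ : ℝ} (hd₀ : 0 < d₀) (hd : ∀ m, B₃ ≤ m → d₀ ≤ d m) {θ : ℝ} (hθ : 0 < θ)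
    (s₁ : ℕ → ℝ) (sm sp : ℕ → ℕ → ℝ)
    (hs₁ : ∀ k ∈ weilPrimeIndex a, IsPrimePow k → 0 ≤ s₁ k ∧ s₁ k ≤ |Real.sin (π * Real.log k / a / 2)|)
    (hsm : ∀ k ∈ weilPrimeIndex a, ∀ k' ∈ weilPrimeIndex a, IsPrimePow k → IsPrimePow k' → k ≠ k' →
      0 ≤ sm k k' ∧ sm k k' ≤ |Real.sin ((π * Real.log k / a - π * Real.log k' / a) / 2)|)
    (hsp : ∀ k ∈ weilPrimeIndex a, ∀ k' ∈ weilPrimeIndex a, IsPrimePow k → IsPrimePow k' →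
      0 ≤ sp k k' ∧ sp k k' ≤ |Real.sin ((π * Real.log k / a + π * Real.log k' / a) / 2)|)
    (N : ℕ) (x : Fin B → ℝ) :
    ∑ m ∈ Finset.Ico B₃ N, (∑ i : Fin B,
        (if (i : ℕ) = 0 then gramCoeff a 0 m else if m = 0 then gramCoeff a i 0
          else (gramCoeff a i m + gramCoeff a i (-(m : ℤ))) / 2) * x i) ^ 2 / d m
      ≤ x ⬝ᵥ (Matrix.of fun i i' : Fin B ↦
          (1 + θ) * (1 / d₀)
          * ((1 + (a * (1 + weilArchDensity (2 * a)) / (π * B₃)) / π) * ((((∑ j : Fin J, ∑ j' : Fin J, ((1 / (((2 * (j : ℕ) + 1) + (2 * (j' : ℕ) + 1) - 1 : ℕ) * (((B₃ - 1 : ℕ) : ℝ)) ^ ((2 * (j : ℕ) + 1) + (2 * (j' : ℕ) + 1) - 1)) + 1 / (((2 * (j : ℕ) + 1) + (2 * (j' : ℕ) + 1) - 1 : ℕ) * (B₃ : ℝ) ^ ((2 * (j : ℕ) + 1) + (2 * (j' : ℕ) + 1) - 1))) / 2) * (((-1 : ℝ) ^ (i : ℕ) * (i : ℝ) ^ (2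 * (j : ℕ))) / 4) * (((-1 : ℝ) ^ (i' : ℕ) * (i' : ℝ) ^ (2 * (j' : ℕ))) / 4))
            + ∑ r' : Fin J, ∑ j : Fin J, ((1 / (((2 * (r' : ℕ) + 2) + (2 * (j : ℕ) + 1) - 1 : ℕ) * (((B₃ - 1 : ℕ) : ℝ)) ^ ((2 * (r' : ℕ) + 2) + (2 * (j : ℕ) + 1) - 1)) + 1 / (((2 * (r' : ℕ) + 2) + (2 * (j : ℕ) + 1) - 1 : ℕ) * (B₃ : ℝ) ^ ((2 * (r' : ℕ) + 2) + (2 * (j : ℕ) + 1) - 1))) / 2) * ((-1 : ℝ) ^ (i : ℕ) * (-((i : ℝ) ^ (2 * (r' : ℕ) + 1)) * ((Complex.digamma (1 / 4 + ((freq a i : ℝ) : ℂ) / 2 * I)).im / 2 + (∑ k ∈ weilPrimeIndex a, (Λ k : ℝ) / Real.sqrt k * Real.sin (freq a i * Real.log k)) - archExpSumSin a i) / π + 4 / a * (Real.exp (a / 2) - Real.exp (-(a / 2))) ^ 2 * (-1 : ℝ) ^ (r' : ℕ) * (a ^ 2 / (4 * π ^ 2)) ^ ((r' : ℕ) + 1)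 * (1 / (1 + 4 * freq a i ^ 2)))) * (((-1 : ℝ) ^ (i' : ℕ) * (i' : ℝ) ^ (2 * (j : ℕ))) / 4))
          + ((∑ j : Fin J, ∑ r' : Fin J, ((1 / (((2 * (j : ℕ) + 1) + (2 * (r' : ℕ) + 2) - 1 : ℕ) * (((B₃ - 1 : ℕ) : ℝ)) ^ ((2 * (j : ℕ) + 1) + (2 * (r' : ℕ) + 2) - 1)) + 1 / (((2 * (j : ℕ) + 1) + (2 * (r' : ℕ) + 2) - 1 : ℕ) * (B₃ : ℝ) ^ ((2 * (j : ℕ) + 1) + (2 * (r' : ℕ) + 2) - 1))) / 2) * (((-1 : ℝ) ^ (i : ℕ) * (i : ℝ) ^ (2 * (j : ℕ))) / 4) * ((-1 : ℝ) ^ (i' : ℕ) * (-((i' : ℝ) ^ (2 * (r' : ℕ) + 1)) * ((Complex.digamma (1 / 4 + ((freq a i' : ℝ) : ℂ) / 2 * I)).im / 2 + (∑ k ∈ weilPrimeIndex a, (Λ k : ℝ) / Real.sqrt k * Real.sin (freq a i' * Real.log k)) - archExpSumSin a i') / π + 4 / a * (Real.exp (a / 2) - Real.exp (-(a / 2)))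 ^ 2 * (-1 : ℝ) ^ (r' : ℕ) * (a ^ 2 / (4 * π ^ 2)) ^ ((r' : ℕ) + 1) * (1 / (1 + 4 * freq a i' ^ 2)))))
            + ∑ r' : Fin J, ∑ r'' : Fin J, ((1 / (((2 * (r' : ℕ) + 2) + (2 * (r'' : ℕ) + 2) - 1 : ℕ) * (((B₃ - 1 : ℕ) : ℝ)) ^ ((2 * (r' : ℕ) + 2) + (2 * (r'' : ℕ) + 2) - 1)) + 1 / (((2 * (r' : ℕ) + 2) + (2 * (r'' : ℕ) + 2) - 1 : ℕ) * (B₃ : ℝ) ^ ((2 * (r' : ℕ) + 2) + (2 * (r'' : ℕ) + 2) - 1))) / 2) * ((-1 : ℝ) ^ (i : ℕ) * (-((i : ℝ) ^ (2 * (r' : ℕ) + 1)) * ((Complex.digamma (1 / 4 + ((freq a i : ℝ) : ℂ) / 2 * I)).im / 2 + (∑ k ∈ weilPrimeIndex a, (Λ k : ℝ) / Real.sqrt k * Real.sin (freq a i * Real.log k)) - archExpSumSin a i) / π + 4 / a * (Real.exp (a / 2) - Real.exp (-(a / 2))) ^ 2 * (-1 : ℝ) ^ (r' : ℕ) * (a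 ^ 2 / (4 * π ^ 2)) ^ ((r' : ℕ) + 1) * (1 / (1 + 4 * freq a i ^ 2)))) * ((-1 : ℝ) ^ (i' : ℕ) * (-((i' : ℝ) ^ (2 * (r'' : ℕ) + 1)) * ((Complex.digamma (1 / 4 + ((freq a i' : ℝ) : ℂ) / 2 * I)).im / 2 + (∑ k ∈ weilPrimeIndex a, (Λ k : ℝ) / Real.sqrt k * Real.sin (freq a i' * Real.log k)) - archExpSumSin a i') / π + 4 / a * (Real.exp (a / 2) - Real.exp (-(a / 2))) ^ 2 * (-1 : ℝ) ^ (r'' : ℕ) * (a ^ 2 / (4 * π ^ 2)) ^ ((r'' : ℕ) + 1) * (1 / (1 + 4 * freq a i' ^ 2))))))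
        + ((((∑ j : Fin J, (∑ j' : Fin J, ((1 / (((2 * (j : ℕ) + 1) + (2 * (j' : ℕ) + 1) - 1 : ℕ) * (((B₃ - 1 : ℕ) : ℝ)) ^ ((2 * (j : ℕ) + 1) + (2 * (j' : ℕ) + 1) - 1)) - 1 / (((2 * (j : ℕ) + 1) + (2 * (j' : ℕ) + 1) - 1 : ℕ) * (B₃ : ℝ) ^ ((2 * (j : ℕ) + 1) + (2 * (j' : ℕ) + 1) - 1))) / 2) * (B : ℝ) ^ (2 * (j' : ℕ) + 1) / (B : ℝ) ^ (2 * (j : ℕ) + 1)) * (((-1 : ℝ) ^ (i : ℕ) * (i : ℝ) ^ (2 * (j : ℕ))) / 4) * (((-1 : ℝ) ^ (i' : ℕ) * (i' : ℝ) ^ (2 * (j : ℕ))) / 4))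
            + ∑ r' : Fin J, (∑ j : Fin J, ((1 / (((2 * (r' : ℕ) + 2) + (2 * (j : ℕ) + 1) - 1 : ℕ) * (((B₃ - 1 : ℕ) : ℝ)) ^ ((2 * (r' : ℕ) + 2) + (2 * (j : ℕ) + 1) - 1)) - 1 / (((2 * (r' : ℕ) + 2) + (2 * (j : ℕ) + 1) - 1 : ℕ) * (B₃ : ℝ) ^ ((2 * (r' : ℕ) + 2) + (2 * (j : ℕ) + 1) - 1))) / 2) * (B : ℝ) ^ (2 * (j : ℕ) + 1) / (B : ℝ) ^ (2 * (r' : ℕ) + 2)) * ((-1 : ℝ) ^ (i : ℕ) * (-((i : ℝ) ^ (2 * (r' : ℕ) + 1)) * ((Complex.digamma (1 / 4 + ((freq a i : ℝ) : ℂ) / 2 * I)).im / 2 + (∑ k ∈ weilPrimeIndex a, (Λ k : ℝ) / Real.sqrt k * Real.sin (freq a i * Real.log k)) - archExpSumSin a i) / π + 4 / a * (Real.exp (a / 2) - Real.exp (-(a / 2))) ^ 2 * (-1 : ℝ) ^ (r' : ℕ) * (a ^ 2 / (4 * π ^ 2)) ^ ((r' : ℕ) + 1) * (1 / (1 + 4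 * freq a i ^ 2)))) * ((-1 : ℝ) ^ (i' : ℕ) * (-((i' : ℝ) ^ (2 * (r' : ℕ) + 1)) * ((Complex.digamma (1 / 4 + ((freq a i' : ℝ) : ℂ) / 2 * I)).im / 2 + (∑ k ∈ weilPrimeIndex a, (Λ k : ℝ) / Real.sqrt k * Real.sin (freq a i' * Real.log k)) - archExpSumSin a i') / π + 4 / a * (Real.exp (a / 2) - Real.exp (-(a / 2))) ^ 2 * (-1 : ℝ) ^ (r' : ℕ) * (a ^ 2 / (4 * π ^ 2)) ^ ((r' : ℕ) + 1) * (1 / (1 + 4 * freq a i' ^ 2)))))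
          + ((∑ j : Fin J, (∑ r' : Fin J, ((1 / (((2 * (j : ℕ) + 1) + (2 * (r' : ℕ) + 2) - 1 : ℕ) * (((B₃ - 1 : ℕ) : ℝ)) ^ ((2 * (j : ℕ) + 1) + (2 * (r' : ℕ) + 2) - 1)) - 1 / (((2 * (j : ℕ) + 1) + (2 * (r' : ℕ) + 2) - 1 : ℕ) * (B₃ : ℝ) ^ ((2 * (j : ℕ) + 1) + (2 * (r' : ℕ) + 2) - 1))) / 2) * (B : ℝ) ^ (2 * (r' : ℕ) + 2) / (B : ℝ) ^ (2 * (j : ℕ) + 1)) * (((-1 : ℝ) ^ (i : ℕ) * (i : ℝ) ^ (2 * (j : ℕ))) / 4) * (((-1 : ℝ) ^ (i' : ℕ) * (i' : ℝ) ^ (2 * (j : ℕ))) / 4))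
            + ∑ r' : Fin J, (∑ r'' : Fin J, ((1 / (((2 * (r' : ℕ) + 2) + (2 * (r'' : ℕ) + 2) - 1 : ℕ) * (((B₃ - 1 : ℕ) : ℝ)) ^ ((2 * (r' : ℕ) + 2) + (2 * (r'' : ℕ) + 2) - 1)) - 1 / (((2 * (r' : ℕ) + 2) + (2 * (r'' : ℕ) + 2) - 1 : ℕ) * (B₃ : ℝ) ^ ((2 * (r' : ℕ) + 2) + (2 * (r'' : ℕ) + 2) - 1))) / 2) * (B : ℝ) ^ (2 * (r'' : ℕ) + 2) / (B : ℝ) ^ (2 * (r' : ℕ) + 2)) * ((-1 : ℝ) ^ (i : ℕ) * (-((i : ℝ) ^ (2 * (r' : ℕ) + 1)) * ((Complex.digamma (1 / 4 + ((freq a i : ℝ) : ℂ) / 2 * I)).im / 2 + (∑ k ∈ weilPrimeIndex a, (Λ k : ℝ) / Real.sqrt k * Real.sin (freq a i * Real.log k)) - archExpSumSin a i) / π + 4 / a * (Real.exp (a / 2) - Real.exp (-(a / 2))) ^ 2 * (-1 : ℝ) ^ (r' : ℕ) * (a ^ 2 / (4 * π ^ 2)) ^ ((r' : ℕ) + 1)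 * (1 / (1 + 4 * freq a i ^ 2)))) * ((-1 : ℝ) ^ (i' : ℕ) * (-((i' : ℝ) ^ (2 * (r' : ℕ) + 1)) * ((Complex.digamma (1 / 4 + ((freq a i' : ℝ) : ℂ) / 2 * I)).im / 2 + (∑ k ∈ weilPrimeIndex a, (Λ k : ℝ) / Real.sqrt k * Real.sin (freq a i' * Real.log k)) - archExpSumSin a i') / π + 4 / a * (Real.exp (a / 2) - Real.exp (-(a / 2))) ^ 2 * (-1 : ℝ) ^ (r' : ℕ) * (a ^ 2 / (4 * π ^ 2)) ^ ((r' : ℕ) + 1) * (1 / (1 + 4 * freq a i' ^ 2))))))))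
        + ((a * (1 + weilArchDensity (2 * a)) / (π * B₃)) / π + ((a * (1 + weilArchDensity (2 * a)) / (π * B₃)) ^ 2 + (∑ k ∈ weilPrimeIndex a, ((Λ k : ℝ) / Real.sqrt k) ^ 2) / 2 + 2 * (a * (1 + weilArchDensity (2 * a)) / (π * B₃)) * (∑ k ∈ weilPrimeIndex a, (Λ k : ℝ) / Real.sqrt k) + ((∑ k ∈ weilPrimeIndex a, ∑ k' ∈ (weilPrimeIndex a).erase k, if sm k k' = 0 then (Λ k : ℝ) / Real.sqrt k * ((Λ k' : ℝ) / Real.sqrt k') else 0) / 2 + (∑ k ∈ weilPrimeIndex a, ∑ k' ∈ weilPrimeIndex a, if sp k k' = 0 then (Λ k : ℝ) / Real.sqrt k * ((Λ k' : ℝ) / Real.sqrt k') else 0) / 2)) / π ^ 2) * ((∑ j : Fin J, ∑ j' : Fin J, ((1 / (((2 * (j : ℕ) + 1) + (2 * (j' : ℕ) + 1) - 1 : ℕ) * (((B₃ - 1 : ℕ) : ℝ)) ^ ((2 * (j : ℕ) + 1) + (2 * (j' : ℕ) + 1) - 1)) + 1 / (((2 * (j : ℕ) + 1) + (2 * (j'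 : ℕ) + 1) - 1 : ℕ) * (B₃ : ℝ) ^ ((2 * (j : ℕ) + 1) + (2 * (j' : ℕ) + 1) - 1))) / 2) * ((-1 : ℝ) ^ (i : ℕ) * (i : ℝ) ^ (2 * (j : ℕ))) * ((-1 : ℝ) ^ (i' : ℕ) * (i' : ℝ) ^ (2 * (j' : ℕ))))
          + ∑ j : Fin J, (∑ j' : Fin J, ((1 / (((2 * (j : ℕ) + 1) + (2 * (j' : ℕ) + 1) - 1 : ℕ) * (((B₃ - 1 : ℕ) : ℝ)) ^ ((2 * (j : ℕ) + 1) + (2 * (j' : ℕ) + 1) - 1)) - 1 / (((2 * (j : ℕ) + 1) + (2 * (j' : ℕ) + 1) - 1 : ℕ) * (B₃ : ℝ) ^ ((2 * (j : ℕ) + 1) + (2 * (j' : ℕ) + 1) - 1))) / 2) * (B : ℝ) ^ (2 * (j' : ℕ) + 1) / (B : ℝ) ^ (2 * (j : ℕ) + 1)) * ((-1 : ℝ) ^ (i : ℕ) * (i : ℝ) ^ (2 * (j : ℕ))) * ((-1 : ℝ) ^ (i' : ℕ) * (i' : ℝ) ^ (2 * (j : ℕ))))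
        + (1 / π ^ 2) * ∑ j : Fin J, (∑ j' : Fin J, ((∑ k ∈ weilPrimeIndex a, ∑ k' ∈ (weilPrimeIndex a).erase k, (Λ k : ℝ) / Real.sqrt k * ((Λ k' : ℝ) / Real.sqrt k') / sm k k') / 2 + (∑ k ∈ weilPrimeIndex a, ∑ k' ∈ weilPrimeIndex a, (Λ k : ℝ) / Real.sqrt k * ((Λ k' : ℝ) / Real.sqrt k') / sp k k') / 2) / (B₃ : ℝ) ^ ((2 * (j : ℕ) + 1) + (2 * (j' : ℕ) + 1)) * (B : ℝ) ^ (2 * (j' : ℕ) + 1) / (B : ℝ) ^ (2 * (j : ℕ) + 1)) * ((-1 : ℝ) ^ (i : ℕ) * (i : ℝ) ^ (2 * (j : ℕ))) * ((-1 : ℝ) ^ (i' : ℕ) * (i' : ℝ) ^ (2 * (j : ℕ)))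
        + (1 / (2 * π)) * ∑ j : Fin J, (∑ j' : Fin J, ((∑ k ∈ weilPrimeIndex a, (Λ k : ℝ) / Real.sqrt k / s₁ k) / (B₃ : ℝ) ^ ((2 * (j : ℕ) + 1) + (2 * (j' : ℕ) + 1)) + (∑ k ∈ weilPrimeIndex a, if s₁ k = 0 then (Λ k : ℝ) / Real.sqrt k else 0) * (1 / (((2 * (j : ℕ) + 1) + (2 * (j' : ℕ) + 1) - 1 : ℕ) * (((B₃ - 1 : ℕ) : ℝ)) ^ ((2 * (j : ℕ) + 1) + (2 * (j' : ℕ) + 1) - 1)))) * (B : ℝ) ^ (2 * (j' : ℕ) + 1) / (B : ℝ) ^ (2 * (j : ℕ) + 1)) * ((-1 : ℝ) ^ (i : ℕ) * (i : ℝ) ^ (2 * (j : ℕ))) * ((-1 : ℝ) ^ (i' : ℕ) * (i' : ℝ) ^ (2 * (j : ℕ)))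
        + (1 / π) * ((∑ j : Fin J, (∑ r' : Fin J, ((∑ k ∈ weilPrimeIndex a, (Λ k : ℝ) / Real.sqrt k / s₁ k) / (B₃ : ℝ) ^ ((2 * (j : ℕ) + 1) + (2 * (r' : ℕ) + 2)) + (∑ k ∈ weilPrimeIndex a, if s₁ k = 0 then (Λ k : ℝ) / Real.sqrt k else 0) * (1 / (((2 * (j : ℕ) + 1) + (2 * (r' : ℕ) + 2) - 1 : ℕ) * (((B₃ - 1 : ℕ) : ℝ)) ^ ((2 * (j : ℕ) + 1) + (2 * (r' : ℕ) + 2) - 1)))) * (B : ℝ) ^ (2 * (r' : ℕ) + 2) / (B : ℝ) ^ (2 * (j : ℕ) + 1)) * ((-1 : ℝ) ^ (i : ℕ) * (i : ℝ) ^ (2 * (j : ℕ))) * ((-1 : ℝ) ^ (i' : ℕ) * (i' : ℝ) ^ (2 * (j : ℕ))))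
          + ∑ r' : Fin J, (∑ j : Fin J, ((∑ k ∈ weilPrimeIndex a, (Λ k : ℝ) / Real.sqrt k / s₁ k) / (B₃ : ℝ) ^ ((2 * (j : ℕ) + 1) + (2 * (r' : ℕ) + 2)) + (∑ k ∈ weilPrimeIndex a, if s₁ k = 0 then (Λ k : ℝ) / Real.sqrt k else 0) * (1 / (((2 * (j : ℕ) + 1) + (2 * (r' : ℕ) + 2) - 1 : ℕ) * (((B₃ - 1 : ℕ) : ℝ)) ^ ((2 * (j : ℕ) + 1) + (2 * (r' : ℕ) + 2) - 1)))) * (B : ℝ) ^ (2 * (j : ℕ) + 1) / (B : ℝ) ^ (2 * (r' : ℕ) + 2)) * ((-1 : ℝ) ^ (i : ℕ) * (-((i : ℝ) ^ (2 * (r' : ℕ) + 1)) * ((Complex.digamma (1 / 4 + ((freq a i : ℝ) : ℂ) / 2 * I)).im / 2 + (∑ k ∈ weilPrimeIndex a, (Λ k : ℝ) / Real.sqrt k * Real.sin (freq a i * Real.log k)) - archExpSumSin a i) / π + 4 / a * (Real.exp (a / 2) - Real.exp (-(a / 2))) ^ 2 * (-1 : ℝ) ^ (r' : ℕ) * (a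 ^ 2 / (4 * π ^ 2)) ^ ((r' : ℕ) + 1) * (1 / (1 + 4 * freq a i ^ 2)))) * ((-1 : ℝ) ^ (i' : ℕ) * (-((i' : ℝ) ^ (2 * (r' : ℕ) + 1)) * ((Complex.digamma (1 / 4 + ((freq a i' : ℝ) : ℂ) / 2 * I)).im / 2 + (∑ k ∈ weilPrimeIndex a, (Λ k : ℝ) / Real.sqrt k * Real.sin (freq a i' * Real.log k)) - archExpSumSin a i') / π + 4 / a * (Real.exp (a / 2) - Real.exp (-(a / 2))) ^ 2 * (-1 : ℝ) ^ (r' : ℕ) * (a ^ 2 / (4 * π ^ 2)) ^ ((r' : ℕ) + 1) * (1 / (1 + 4 * freq a i' ^ 2))))))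
        + (if i = i' then (1 + θ⁻¹) * ((B : ℝ) / d₀) * ((2 * (π / 4 + (∑ k ∈ weilPrimeIndex a, (Λ k : ℝ) / Real.sqrt k) + a * (1 + weilArchDensity (2 * a)) / π) * (i : ℝ) ^ (2 * J) / π + 4 / a * (Real.exp (a / 2) - Real.exp (-(a / 2))) ^ 2 * (a ^ 2 / (4 * π ^ 2)) ^ (J + 1) * (1 / (1 + 4 * freq a i ^ 2)))) ^ 2 * (1 / ((4 * J + 1 : ℕ) * (((B₃ - 1 : ℕ) : ℝ)) ^ (4 * J + 1))) else 0)) *ᵥ x := by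
  refine (even_tailJJ_majorant ha hB hBB hB₃ J d hd₀ hd hθ s₁ sm sp hs₁ hsm hsp N x).trans (le_of_eq ?_)
  rw [dotProduct_mulVec_eq_sum_sum]
  simp only [Matrix.of_apply]
  rw [sum_sum_mul_skeletonTJ_eq]
  rw [sum_sum_mul_gram2_divLR_eq, sum_sum_mul_diag_div_eq, sum_sum_mul_diag_div_eq, sum_sum_mul_gram2_divR_eq,
    sum_sum_mul_gram2_divL_eq, sum_sum_mul_gram2_eq, sum_sum_mul_gram2_eq, sum_sum_mul_diag_eq, sum_sum_mul_diag_eq,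
    sum_sum_mul_diag_eq, sum_sum_mul_diag_eq, sum_sum_mul_diag_eq, sum_sum_mul_diag_eq, sum_sum_mul_diag_eq]

end Tail

end Summit.RiemannHypothesis.RiemannHypothesis.Theorems.WeilFormatC

end
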